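import Literature.MathematicalPhysics.KineticTheory.SiteChainUniformReach
import Literature.MathematicalPhysics.KineticTheory.ConfinedLocalMinorizationUniform
import HarnessLib

/-!
# Site-inhomogeneous chains: a minorisation on energy sublevel sets, uniformly in the temperature bias

Topic `Literature/MathematicalPhysics/KineticTheory`, grouping namespace `…KineticTheory.HeatConduction`.
The minorisation input of a Harris bound with constants UNIFORM over the kernels
`P^δ_t = P.langevinKernel N (T + δ/2) (T - δ/2) t`, `|δ| ≤ δ₀ < 2T`, of a uniformly confining
site-dependent chain (SiteChain version of the pinned chain's assembly in the Summits tree,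
`…OddSectorIrreversibilityCorrectorTheoryUniformMixing.lean`):

* `smul_bathVec`, `SiteChain.noiseVecL_eq_smul`, `SiteChain.noiseVecR_eq_smul` — the bath temperatures
  enter the noise vectors through a scalar factor;
* `SiteChain.UniformlyConfining.minorization_at_one_uniform_temps` — the model-free uniform local
  minorisation `ConfinedDrift.minorization_at_one_uniform` for the chain: at reference temperatures
  `T_L⁰, T_R⁰ > 0` with Kalman's condition at the equilibrium `0` for the left noise vector, ONE
  triple `(ε₁, r, c)` minorises `P^{T_L,T_R}_1(z, ·) ≥ c Leb` on `B(0, r)` for `‖z‖ < ε₁` and all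
  temperatures whose amplitude ratios `√(2γT_b)/√(2γT_b⁰)` are `ε₁`-close to `1`;
* `SiteChain.UniformlyConfining.minorization_at_one_uniform_band` — the same with one triple for the
  whole band `(T + δ/2, T - δ/2)`, `|δ| ≤ δ₀` (a finite subcover of the compact band);
* `SiteChain.UniformlyConfining.exists_uniform_minorization_sublevel` — **for every energy level `E`:
  an integer time `n`, `α > 0` and a probability measure `ν` with `P^δ_n(x, ·) ≥ α ν` for all
  `H(x) ≤ E` and all `|δ| ≤ δ₀`** (uniform reachability of `B(0, ε₁)` from `{H ≤ E}`,
  `SiteChainUniformReach.lean`, composed by Chapman–Kolmogorov with the band minorisation).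

## References

* N. Cuneo, J.-P. Eckmann, M. Hairer, L. Rey-Bellet, Electron. J. Probab. **23** (2018) no. 55,
  Prop. 3.6 (proof), Prop. 3.8.
* M. Hairer, J. C. Mattingly, Progr. Probab. **63** (2011) 109–117, Assumption 2.
-/

noncomputable section

open MeasureTheory ProbabilityTheory Filter Topology Set Metric
open scoped NNReal ENNReal

namespace Literature.MathematicalPhysics.KineticTheory.HeatConduction

open Literature.MathematicalPhysics.KineticTheory Literature.Probability.Process

variable {N : ℕ}

/-! ### The temperatures enter the noise vectors through a scalar -/

/-- `l • bathVec N k c = bathVec N k (l c)`. [folklore] -/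
theorem smul_bathVec (N k : ℕ) (l c : ℝ) : l • bathVec N k c = bathVec N k (l * c) := by
  ext i
  · simp [bathVec]
  · simp only [bathVec, Prod.smul_snd, Pi.smul_apply, smul_eq_mul, mul_ite, mul_zero]

namespace SiteChain

variable (P : SiteChain)

/-- The left noise vector at temperature `T_L` is the one at a reference temperature `T_L⁰` with
`γT_L⁰ > 0`, rescaled by the amplitude ratio `√(2γT_L)/√(2γT_L⁰)`. [folklore] -/
theorem noiseVecL_eq_smul (N : ℕ) {TL₀ : ℝ} (h₀ : 0 < P.γ * TL₀) (T_L : ℝ) :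
    P.noiseVecL N T_L = (Real.sqrt (2 * P.γ * T_L) / Real.sqrt (2 * P.γ * TL₀)) • P.noiseVecL N TL₀ := by
  have hne : Real.sqrt (2 * P.γ * TL₀) ≠ 0 := (Real.sqrt_pos.2 (by linarith)).ne'
  unfold noiseVecL
  rw [smul_bathVec, div_mul_cancel₀ _ hne]

/-- The right noise vector at temperature `T_R` is the one at a reference temperature `T_R⁰` with
`γT_R⁰ > 0`, rescaled by the amplitude ratio. [folklore] -/
theorem noiseVecR_eq_smul (N : ℕ) {TR₀ : ℝ} (h₀ : 0 < P.γ * TR₀) (T_R : ℝ) :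
    P.noiseVecR N T_R = (Real.sqrt (2 * P.γ * T_R) / Real.sqrt (2 * P.γ * TR₀)) • P.noiseVecR N TR₀ := by
  have hne : Real.sqrt (2 * P.γ * TR₀) ≠ 0 := (Real.sqrt_pos.2 (by linarith)).ne'
  unfold noiseVecR
  rw [smul_bathVec, div_mul_cancel₀ _ hne]

namespace UniformlyConfining

variable {P}

/-! ### The local minorisation at time one, uniformly for nearby temperatures -/

/-- **Local minorisation of a site-dependent chain at time one near the equilibrium, uniformly for
nearby bath temperatures.** For a uniformly confining chain whose Langevin drift vanishes at `0` and
satisfies Kalman's condition there with the left noise vector, and reference temperatures with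
`γT_L⁰, γT_R⁰ > 0`: there are `ε₁, r > 0` and `c > 0` such that `P^{T_L,T_R}_1(z, T) ≥ c · Leb(T)` for
every measurable `T ⊆ B(0, r)`, every `‖z‖ < ε₁` and all bath temperatures with
`|√(2γT_L)/√(2γT_L⁰) - 1| < ε₁`, `|√(2γT_R)/√(2γT_R⁰) - 1| < ε₁`
(`ConfinedDrift.minorization_at_one_uniform` and `noiseVecL_eq_smul`).
[cite: CuneoEckmannHairerReyBellet2018, Prop 3.6 (proof)] -/
theorem minorization_at_one_uniform_temps (hP : P.UniformlyConfining) (N : ℕ)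
    (hY0 : P.langevinDrift N 0 = 0) {TL₀ TR₀ : ℝ} (hL : 0 < P.γ * TL₀) (hR : 0 < P.γ * TR₀)
    (hKal : ∀ ℓ : PhaseSpace N →ₗ[ℝ] ℝ,
      (∀ j : ℕ, ℓ (((fderiv ℝ (P.langevinDrift N) 0) ^ j) (P.noiseVecL N TL₀)) = 0) → ℓ = 0) :
    ∃ ε₁ : ℝ, 0 < ε₁ ∧ ∃ r : ℝ, 0 < r ∧ ∃ c : ℝ≥0∞, 0 < c ∧
      ∀ T_L T_R : ℝ, |Real.sqrt (2 * P.γ * T_L) / Real.sqrt (2 * P.γ * TL₀) - 1| < ε₁ →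
        |Real.sqrt (2 * P.γ * T_R) / Real.sqrt (2 * P.γ * TR₀) - 1| < ε₁ →
        ∀ z : PhaseSpace N, ‖z‖ < ε₁ → ∀ T ⊆ ball (0 : PhaseSpace N) r, MeasurableSet T →
          c * volume T ≤ P.langevinKernel N T_L T_R 1 z T := by
  haveI hpiP : (volume : Measure (Fin N → ℝ)).IsAddHaarMeasure := isAddHaarMeasure_volume_pi _
  haveI hvolP : (volume : Measure (PhaseSpace N)).IsAddHaarMeasure :=
    Measure.prod.instIsAddHaarMeasure (volume : Measure (Fin N → ℝ)) (volume : Measure (Fin N → ℝ))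
  have hY : ContDiff ℝ 1 (P.langevinDrift N) := P.contDiff_one_langevinDrift hP.contDiff_U hP.contDiff_V N
  obtain ⟨ε₁, hε₁, r, hr, c, hc, hmin⟩ :=
    (hP.confinedDrift N).toConfinedDrift.minorization_at_one_uniform hY hY0 (hP.noiseVecL_mem_noise N TL₀)
      (hP.noiseVecR_mem_noise N TR₀) hKal (volume : Measure (PhaseSpace N))
  refine ⟨ε₁, hε₁, r, hr, c, hc, fun T_L T_R hTL hTR z hz T hT hTm => ?_⟩
  have h := hmin _ _ hTL hTR z (mem_ball_zero_iff.2 hz) T hT hTm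
  unfold langevinKernel
  rw [P.noiseVecL_eq_smul N hL T_L, P.noiseVecR_eq_smul N hR T_R]
  exact h

/-! ### One triple of constants for the whole temperature band -/

/-- **The local minorisation at time one with ONE triple of constants for the whole band of
temperatures `(T + δ/2, T - δ/2)`, `|δ| ≤ δ₀`** (`0 ≤ δ₀ < 2T`; Kalman's condition at `0` for every
left temperature `> 0`): a finite subcover of the compact band by the neighbourhoods of
`minorization_at_one_uniform_temps`. [cite: CuneoEckmannHairerReyBellet2018, Prop 3.6 (proof)] -/
theorem minorization_at_one_uniform_band (hP : P.UniformlyConfining) (N : ℕ) (hγ : 0 < P.γ)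
    (hY0 : P.langevinDrift N 0 = 0)
    (hKal : ∀ T_L : ℝ, 0 < T_L → ∀ ℓ : PhaseSpace N →ₗ[ℝ] ℝ,
      (∀ j : ℕ, ℓ (((fderiv ℝ (P.langevinDrift N) 0) ^ j) (P.noiseVecL N T_L)) = 0) → ℓ = 0)
    {T δ₀ : ℝ} (hδ₀ : 0 ≤ δ₀) (hδ₀T : δ₀ < 2 * T) :
    ∃ ε₁ : ℝ, 0 < ε₁ ∧ ∃ r : ℝ, 0 < r ∧ ∃ c : ℝ≥0∞, 0 < c ∧
      ∀ δ : ℝ, |δ| ≤ δ₀ → ∀ z : PhaseSpace N, ‖z‖ < ε₁ → ∀ T' ⊆ ball (0 : PhaseSpace N) r,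
        MeasurableSet T' → c * volume T' ≤ P.langevinKernel N (T + δ / 2) (T - δ / 2) 1 z T' := by
  set K : Set ℝ := Icc (-δ₀) δ₀ with hK
  have hKc : IsCompact K := isCompact_Icc
  -- the amplitude-ratio maps
  set aL : ℝ → ℝ := fun δ => Real.sqrt (2 * P.γ * (T + δ / 2)) with haL
  set aR : ℝ → ℝ := fun δ => Real.sqrt (2 * P.γ * (T - δ / 2)) with haR
  have haLc : Continuous aL := Real.continuous_sqrt.comp (by fun_prop)
  have haRc : Continuous aR := Real.continuous_sqrt.comp (by fun_prop)
  have htemps : ∀ δ ∈ K, 0 < T + δ / 2 ∧ 0 < T - δ / 2 := fun δ hδ => by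
    rw [hK, mem_Icc] at hδ
    constructor <;> linarith
  -- the local constants at each reference bias (junk outside the band)
  have hloc : ∀ δ' : ℝ, ∃ ε₁ r : ℝ, ∃ c : ℝ≥0∞, 0 < ε₁ ∧ 0 < r ∧ 0 < c ∧ (δ' ∈ K →
      ∀ δ : ℝ, |aL δ / aL δ' - 1| < ε₁ → |aR δ / aR δ' - 1| < ε₁ →
        ∀ z : PhaseSpace N, ‖z‖ < ε₁ → ∀ T' ⊆ ball (0 : PhaseSpace N) r, MeasurableSet T' →
          c * volume T' ≤ P.langevinKernel N (T + δ / 2) (T - δ / 2) 1 z T') := by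
    intro δ'
    by_cases hδ' : δ' ∈ K
    · obtain ⟨hL, hR⟩ := htemps δ' hδ'
      obtain ⟨ε₁, hε₁, r, hr, c, hc, hmin⟩ := hP.minorization_at_one_uniform_temps N hY0
        (mul_pos hγ hL) (mul_pos hγ hR) (hKal _ hL)
      exact ⟨ε₁, r, c, hε₁, hr, hc, fun _ δ hδL hδR z hz T' hT' hT'm => hmin _ _ hδL hδR z hz T' hT' hT'm⟩
    · exact ⟨1, 1, 1, one_pos, one_pos, one_pos, fun h => absurd h hδ'⟩
  choose ε₁f rf cf hε₁f hrf hcf hminf using hloc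
  -- the open neighbourhoods
  set U : ℝ → Set ℝ := fun δ' => {δ | |aL δ / aL δ' - 1| < ε₁f δ' ∧ |aR δ / aR δ' - 1| < ε₁f δ'} with hU
  have hUo : ∀ δ', IsOpen (U δ') := fun δ' =>
    (isOpen_lt (((haLc.div_const _).sub continuous_const).abs) continuous_const).inter
      (isOpen_lt (((haRc.div_const _).sub continuous_const).abs) continuous_const)
  have hmemU : ∀ δ' ∈ K, δ' ∈ U δ' := fun δ' hδ' => by
    obtain ⟨hL, hR⟩ := htemps δ' hδ'
    have h1 : aL δ' ≠ 0 := (Real.sqrt_pos.2 (mul_pos (mul_pos two_pos hγ) hL)).ne'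
    have h2 : aR δ' ≠ 0 := (Real.sqrt_pos.2 (mul_pos (mul_pos two_pos hγ) hR)).ne'
    refine ⟨?_, ?_⟩
    · rw [div_self h1, sub_self, abs_zero]; exact hε₁f δ'
    · rw [div_self h2, sub_self, abs_zero]; exact hε₁f δ'
  obtain ⟨F, hFK, hcover⟩ := hKc.elim_nhds_subcover U fun δ' hδ' => (hUo δ').mem_nhds (hmemU δ' hδ')
  have h0K : (0 : ℝ) ∈ K := by rw [hK, mem_Icc]; constructor <;> linarith
  have hFne : F.Nonempty := by
    have h := hcover h0K
    simp only [mem_iUnion] at h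
    obtain ⟨δ', hδ'F, -⟩ := h
    exact ⟨δ', hδ'F⟩
  -- the uniform constants: minima over the finite subcover
  refine ⟨F.inf' hFne ε₁f, (Finset.lt_inf'_iff hFne).2 fun δ' _ => hε₁f δ',
    F.inf' hFne rf, (Finset.lt_inf'_iff hFne).2 fun δ' _ => hrf δ',
    F.inf' hFne cf, (Finset.lt_inf'_iff hFne).2 fun δ' _ => hcf δ', fun δ hδ z hz T' hT' hT'm => ?_⟩
  have hδK : δ ∈ K := by rw [hK, mem_Icc]; constructor <;> linarith [abs_le.1 hδ]
  have h := hcover hδK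
  simp only [mem_iUnion] at h
  obtain ⟨δ', hδ'F, hδU⟩ := h
  have hmin := hminf δ' (hFK δ' hδ'F) δ hδU.1 hδU.2 z (hz.trans_le (Finset.inf'_le _ hδ'F)) T'
    (hT'.trans (ball_subset_ball (Finset.inf'_le _ hδ'F))) hT'm
  exact (mul_le_mul' (Finset.inf'_le _ hδ'F) le_rfl).trans hmin

/-! ### The minorisation on energy sublevel sets at an integer time -/

set_option maxHeartbeats 800000 in
/-- **Uniform minorisation on energy sublevel sets.** For a uniformly confining site-dependent chain
with `γ > 0`, `N ≥ 1`, all `V_i'` injective, the origin the only critical point of the potential and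
an equilibrium of the Langevin drift, Kalman's condition at `0` for every left temperature `> 0`, and
an energy locally coercive at `0` (`{H < η₀} ⊆ B(0, ρ)` for some `η₀ > H(0)`, for every `ρ > 0`): for
every band `|δ| ≤ δ₀` (`0 ≤ δ₀ < 2T`) and every energy level `E` there are an integer time `n ≥ 1`,
`α > 0` and a probability measure `ν` with `P^δ_n(x, ·) ≥ α ν` for all `H(x) ≤ E` and all `|δ| ≤ δ₀`.
Proof: reach `B(0, ε₁)` from `{H ≤ E}` by an integer time `n₀` with probability `≥ p`, uniformly
(`le_langevinKernel_ball_uniform`), then minorise at time one from the ball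
(`minorization_at_one_uniform_band`); Chapman–Kolmogorov.
[cite: CuneoEckmannHairerReyBellet2018, Prop 3.8 (proof)] -/
theorem exists_uniform_minorization_sublevel (hP : P.UniformlyConfining) (N : ℕ) (hγ : 0 < P.γ)
    (hN : 0 < N) (hVinj : ∀ i, Function.Injective (deriv (P.V i)))
    (hcrit : ∀ q : Fin N → ℝ, (∀ i, P.dPotential N i q = 0) → q = 0)
    (hY0 : P.langevinDrift N 0 = 0)
    (hKal : ∀ T_L : ℝ, 0 < T_L → ∀ ℓ : PhaseSpace N →ₗ[ℝ] ℝ,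
      (∀ j : ℕ, ℓ (((fderiv ℝ (P.langevinDrift N) 0) ^ j) (P.noiseVecL N T_L)) = 0) → ℓ = 0)
    (hcoer : ∀ ρ : ℝ, 0 < ρ → ∃ η₀ : ℝ, P.hamiltonian N 0 < η₀ ∧
      ∀ x : PhaseSpace N, P.hamiltonian N x < η₀ → ‖x‖ < ρ)
    {T δ₀ : ℝ} (hδ₀ : 0 ≤ δ₀) (hδ₀T : δ₀ < 2 * T) (E : ℝ) :
    ∃ (n : ℕ) (α : ℝ≥0) (ν : Measure (PhaseSpace N)), 0 < n ∧ 0 < α ∧ IsProbabilityMeasure ν ∧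
      ∀ δ : ℝ, |δ| ≤ δ₀ → ∀ x : PhaseSpace N, P.hamiltonian N x ≤ E →
        α • ν ≤ P.langevinKernel N (T + δ / 2) (T - δ / 2) n x := by
  -- the band minorisation at time one
  obtain ⟨ε₁, hε₁, r, hr, c, hc, hmin1⟩ := hP.minorization_at_one_uniform_band N hγ hY0 hKal hδ₀ hδ₀T
  -- uniform reachability of `B(0, ε₁)` from `{H ≤ E}`
  obtain ⟨η₀, h0η, hcoer'⟩ := hcoer (ε₁ / 2) (half_pos hε₁)
  set Tmax : ℝ := T + δ₀ / 2 with hTmax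
  obtain ⟨s₁, hs₁⟩ := hP.le_langevinKernel_ball_uniform N hγ hN hVinj hcrit E h0η hcoer' Tmax
  set n₀ : ℕ := ⌈(s₁ : ℝ)⌉₊ with hn₀
  have hs₁n₀ : s₁ ≤ (n₀ : ℝ≥0) := by
    rw [← NNReal.coe_le_coe, NNReal.coe_natCast]
    exact Nat.le_ceil _
  obtain ⟨p, hp, hreach⟩ := hs₁ (n₀ : ℝ≥0) hs₁n₀
  -- the kernels and Chapman–Kolmogorov
  set κ : ℝ → ℝ≥0 → Kernel (PhaseSpace N) (PhaseSpace N) :=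
    fun δ t => P.langevinKernel N (T + δ / 2) (T - δ / 2) t with hκ
  have h_add : ∀ (δ : ℝ) (s t : ℝ≥0), κ δ (s + t) = κ δ t ∘ₖ κ δ s := fun δ s t =>
    hP.langevinKernel_add N _ _ s t
  -- the minorising measure and its normalisation
  haveI hpiP : (volume : Measure (Fin N → ℝ)).IsAddHaarMeasure := isAddHaarMeasure_volume_pi _
  haveI hvolP : (volume : Measure (PhaseSpace N)).IsAddHaarMeasure :=
    Measure.prod.instIsAddHaarMeasure (volume : Measure (Fin N → ℝ)) (volume : Measure (Fin N → ℝ))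
  have hball0 : volume (ball (0 : PhaseSpace N) r) ≠ 0 := (measure_ball_pos volume 0 hr).ne'
  have hballtop : volume (ball (0 : PhaseSpace N) r) ≠ ∞ := measure_ball_lt_top.ne
  set ν₀ : Measure (PhaseSpace N) := c • volume.restrict (ball (0 : PhaseSpace N) r) with hν₀
  set νP : Measure (PhaseSpace N) :=
    (volume (ball (0 : PhaseSpace N) r))⁻¹ • volume.restrict (ball (0 : PhaseSpace N) r) with hνP
  haveI hνPprob : IsProbabilityMeasure νP := by
    refine ⟨?_⟩
    rw [hνP, Measure.smul_apply, Measure.restrict_apply_univ, smul_eq_mul, ENNReal.inv_mul_cancel hball0 hballtop]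
  -- the constant (truncated at `1` for finiteness)
  set αE : ℝ≥0∞ := min (p * (c * volume (ball (0 : PhaseSpace N) r))) 1 with hαE
  have hαEtop : αE ≠ ∞ := ne_top_of_le_ne_top ENNReal.one_ne_top (min_le_right _ _)
  have hαE0 : αE ≠ 0 := by
    rw [hαE]
    exact (lt_min (pos_iff_ne_zero.2 (mul_ne_zero hp.ne' (mul_ne_zero hc.ne' hball0))) one_pos).ne'
  set α : ℝ≥0 := αE.toNNReal with hαdef
  have hαcoe : (α : ℝ≥0∞) = αE := ENNReal.coe_toNNReal hαEtop
  have hα0 : 0 < α := by rw [← ENNReal.coe_pos, hαcoe]; exact pos_iff_ne_zero.2 hαE0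
  refine ⟨n₀ + 1, α, νP, Nat.succ_pos _, hα0, hνPprob, fun δ hδ x hx => ?_⟩
  have h1 := abs_le.1 hδ
  have hLm : T + δ / 2 ≤ Tmax := by rw [hTmax]; linarith
  have hRm : T - δ / 2 ≤ Tmax := by rw [hTmax]; linarith
  -- reach the ball by time `n₀`
  have hpx : p ≤ κ δ (n₀ : ℝ≥0) x (ball 0 ε₁) := hreach _ _ hLm hRm x hx
  -- the local minorisation at time one, from the ball
  have hν₀le : ∀ w ∈ ball (0 : PhaseSpace N) ε₁, ν₀ ≤ κ δ 1 w := by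
    intro w hw
    refine Measure.le_iff.2 fun A hA => ?_
    rw [hν₀, Measure.smul_apply, Measure.restrict_apply hA, smul_eq_mul]
    exact (hmin1 δ hδ w (mem_ball_zero_iff.1 hw) (A ∩ ball 0 r) inter_subset_right
      (hA.inter measurableSet_ball)).trans (measure_mono inter_subset_left)
  -- Chapman–Kolmogorov
  have hcomp : (κ δ (n₀ : ℝ≥0) x (ball 0 ε₁)) • ν₀ ≤ κ δ ((n₀ : ℝ≥0) + 1) x :=
    MarkovSemigroup.smul_le_comp (κ δ) (h_add δ) (n₀ : ℝ≥0) 1 x (ball 0 ε₁) hν₀le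
  have hncast : (((n₀ + 1 : ℕ) : ℝ≥0)) = (n₀ : ℝ≥0) + 1 := by push_cast; ring
  show α • νP ≤ κ δ ((n₀ + 1 : ℕ) : ℝ≥0) x
  rw [hncast]
  refine le_trans ?_ hcomp
  refine Measure.le_iff'.2 fun A => ?_
  have eL : (α • νP) A = αE * ((volume (ball (0 : PhaseSpace N) r))⁻¹ * volume.restrict (ball (0 : PhaseSpace N) r) A) := by
    rw [Measure.smul_apply, ENNReal.smul_def, smul_eq_mul, hαcoe, hνP, Measure.smul_apply, smul_eq_mul]
  have eR : ((κ δ (n₀ : ℝ≥0) x (ball 0 ε₁)) • ν₀) A =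
      κ δ (n₀ : ℝ≥0) x (ball 0 ε₁) * (c * volume.restrict (ball (0 : PhaseSpace N) r) A) := by
    rw [Measure.smul_apply, smul_eq_mul, hν₀, Measure.smul_apply, smul_eq_mul]
  rw [eL, eR]
  calc αE * ((volume (ball (0 : PhaseSpace N) r))⁻¹ * volume.restrict (ball 0 r) A)
      ≤ p * (c * volume (ball (0 : PhaseSpace N) r)) *
          ((volume (ball (0 : PhaseSpace N) r))⁻¹ * volume.restrict (ball 0 r) A) :=
        mul_le_mul' (min_le_left _ _) le_rfl
    _ = p * (c * volume.restrict (ball 0 r) A) *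
          (volume (ball (0 : PhaseSpace N) r) * (volume (ball (0 : PhaseSpace N) r))⁻¹) := by ring
    _ = p * (c * volume.restrict (ball 0 r) A) := by rw [ENNReal.mul_inv_cancel hball0 hballtop, mul_one]
    _ ≤ κ δ (n₀ : ℝ≥0) x (ball 0 ε₁) * (c * volume.restrict (ball 0 r) A) := mul_le_mul' hpx le_rfl

end UniformlyConfining

end SiteChain

end Literature.MathematicalPhysics.KineticTheory.HeatConduction

end
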